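import Literature.Analysis.SpecialFunctions.HypergeometricODE
import Mathlib.Analysis.SpecialFunctions.Pow.Deriv
import Mathlib.Analysis.Calculus.MeanValue
import HarnessLib

/-!
# Kummer's solutions of the hypergeometric equation at `z = 1` and their Wronskian

Continuation of `HypergeometricODE.lean` (`₂F₁ a b c` solves `z(1−z)w″ + (c − (a+b+1)z)w′ − abw = 0`
on the unit disc, DLMF 15.10.1). The two Kummer solutions attached to the regular singular point
`z = 1` are `w₃(z) = ₂F₁(a, b; a+b−c+1; 1−z)` and `w₄(z) = (1−z)^{c−a−b} ₂F₁(c−a, c−b; c−a−b+1; 1−z)`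
(DLMF 15.10.13–14, principal power). With `s = c − a − b`:

* `kummer₃`, `kummer₄`, their `z`-derivatives `kummer₃Deriv(₂)`, `kummer₄Deriv(₂)` (DLMF 15.5.1,
  chain/product rule), `kummer₃_ode` on `‖1 − z‖ < 1` (`a+b−c+1 ∉ −ℕ`) and
  `kummer₄_ode` on `‖1 − z‖ < 1`, `1 − z ∉ (−∞,0]` (`c−a−b+1 ∉ −ℕ`; the Euler-factor
  algebra `ode_euler_factor`: `H` solves the `(c−a, c−b, c)` equation ⇒ `(1−z)^{s}H` solves the
  `(a, b, c)` one);
* the real segment `0 < x < 1` and the behaviour at `x → 1⁻`: `w₃ → 1`, `(1−x)w₃′ → 0`,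
  `(1−x)^{−s}w₄ = w₃(c−a,c−b,c;·) → 1`, `(1−x)^{1−s}w₄′ → −s`;
* `kummer_wronskian` — `w₃w₄′ − w₃′w₄ = (a+b−c) x^{−c}(1−x)^{c−a−b−1}` on `(0,1)` (Abel's
  identity: `x^{c}(1−x)^{1−s}W` has zero derivative and tends to `−s` at `1⁻`), hence
  `kummer_wronskian_ne_zero` for `s ≠ 0` — the inputs of the connection formula DLMF 15.8.4.

References: NIST DLMF §15.10(ii), (15.10.13), (15.10.14), (15.5.1), (1.13.5) [DLMF];
Andrews–Askey–Roy, *Special Functions* (1999), §2.3 [AndrewsAskeyRoy1999].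
-/

noncomputable section

open Filter Metric Set
open scoped Topology

namespace Literature.Analysis.SpecialFunctions.Hypergeometric

/-! ### Definitions -/

/-- Kummer's solution `w₃(z) = ₂F₁(a, b; a+b−c+1; 1−z)` of the hypergeometric equation
(regular at `z = 1`, value `1` there). [cite: DLMF, 15.10.13] -/
def kummer₃ (a b c z : ℂ) : ℂ := ₂F₁ a b (a + b - c + 1) (1 - z)

/-- `w₃′(z) = −(ab/(a+b−c+1)) ₂F₁(a+1, b+1; a+b−c+2; 1−z)` (DLMF 15.5.1 and the chain rule).
[cite: DLMF, 15.5.1] -/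
def kummer₃Deriv (a b c z : ℂ) : ℂ :=
  -(a * b / (a + b - c + 1) * ₂F₁ (a + 1) (b + 1) (a + b - c + 2) (1 - z))

/-- `w₃″(z) = (ab/(a+b−c+1))((a+1)(b+1)/(a+b−c+2)) ₂F₁(a+2, b+2; a+b−c+3; 1−z)`.
[cite: DLMF, 15.5.1] -/
def kummer₃Deriv₂ (a b c z : ℂ) : ℂ :=
  a * b / (a + b - c + 1) *
    ((a + 1) * (b + 1) / (a + b - c + 2) * ₂F₁ (a + 2) (b + 2) (a + b - c + 3) (1 - z))

/-- Kummer's solution `w₄(z) = (1−z)^{c−a−b} ₂F₁(c−a, c−b; c−a−b+1; 1−z)` (principal power),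
written as `(1−z)^{c−a−b} · w₃(c−a, c−b, c; z)`. [cite: DLMF, 15.10.14] -/
def kummer₄ (a b c z : ℂ) : ℂ := (1 - z) ^ (c - a - b) * kummer₃ (c - a) (c - b) c z

/-- `w₄′(z) = −(c−a−b)(1−z)^{c−a−b−1} w₃(c−a,c−b,c;z) + (1−z)^{c−a−b} w₃′(c−a,c−b,c;z)`.
[cite: DLMF, 15.10.14] -/
def kummer₄Deriv (a b c z : ℂ) : ℂ :=
  -((c - a - b) * (1 - z) ^ (c - a - b - 1)) * kummer₃ (c - a) (c - b) c z +
    (1 - z) ^ (c - a - b) * kummer₃Deriv (c - a) (c - b) c z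

/-- `w₄″(z) = s(s−1)(1−z)^{s−2} w₃(c−a,c−b,c;z) − 2s(1−z)^{s−1} w₃′(c−a,c−b,c;z)
+ (1−z)^{s} w₃″(c−a,c−b,c;z)`, `s = c−a−b`. [cite: DLMF, 15.10.14] -/
def kummer₄Deriv₂ (a b c z : ℂ) : ℂ :=
  (c - a - b) * (c - a - b - 1) * (1 - z) ^ (c - a - b - 2) * kummer₃ (c - a) (c - b) c z -
    2 * ((c - a - b) * (1 - z) ^ (c - a - b - 1)) * kummer₃Deriv (c - a) (c - b) c z +
    (1 - z) ^ (c - a - b) * kummer₃Deriv₂ (c - a) (c - b) c z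

/-- `w₃(c−a, c−b, c; z) = ₂F₁(c−a, c−b; c−a−b+1; 1−z)`. [cite: DLMF, 15.10.14] -/
theorem kummer₃_sub_sub (a b c z : ℂ) :
    kummer₃ (c - a) (c - b) c z = ₂F₁ (c - a) (c - b) (c - a - b + 1) (1 - z) := by
  rw [kummer₃, show c - a + (c - b) - c + 1 = c - a - b + 1 by ring]

/-- `w₄(z) = (1−z)^{c−a−b} ₂F₁(c−a, c−b; c−a−b+1; 1−z)`. [cite: DLMF, 15.10.14] -/
theorem kummer₄_eq (a b c z : ℂ) :
    kummer₄ a b c z = (1 - z) ^ (c - a - b) * ₂F₁ (c - a) (c - b) (c - a - b + 1) (1 - z) := by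
  rw [kummer₄, kummer₃_sub_sub]

/-! ### `w₃` solves the hypergeometric equation on `‖1 − z‖ < 1` -/

section Kummer3

variable (a b c : ℂ)

/-- `w₃` has derivative `w₃′` on `‖1 − z‖ < 1`. [cite: DLMF, 15.10.13] -/
theorem hasDerivAt_kummer₃ {z : ℂ} (hz : ‖1 - z‖ < 1) :
    HasDerivAt (kummer₃ a b c) (kummer₃Deriv a b c z) z := by
  have h1 : HasDerivAt (fun w : ℂ => 1 - w) (-1) z := (hasDerivAt_id' z).const_sub 1
  have h := (hasDerivAt_ordinaryHypergeometric (a := a) (b := b) (c := a + b - c + 1) hz).comp z h1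
  rw [show a + b - c + 1 + 1 = a + b - c + 2 by ring] at h
  exact h.congr_deriv (by simp only [kummer₃Deriv]; ring)

/-- `w₃′` has derivative `w₃″` on `‖1 − z‖ < 1`. [cite: DLMF, 15.10.13] -/
theorem hasDerivAt_kummer₃Deriv {z : ℂ} (hz : ‖1 - z‖ < 1) :
    HasDerivAt (kummer₃Deriv a b c) (kummer₃Deriv₂ a b c z) z := by
  have h1 : HasDerivAt (fun w : ℂ => 1 - w) (-1) z := (hasDerivAt_id' z).const_sub 1
  have h := (((hasDerivAt_ordinaryHypergeometric (a := a + 1) (b := b + 1) (c := a + b - c + 2)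
    hz).comp z h1).const_mul (a * b / (a + b - c + 1))).neg
  rw [show a + 1 + 1 = a + 2 by ring, show b + 1 + 1 = b + 2 by ring,
    show a + b - c + 2 + 1 = a + b - c + 3 by ring] at h
  exact h.congr_deriv (by simp only [kummer₃Deriv₂]; ring)

variable {a b c}

/-- **Kummer's solution `w₃` solves the hypergeometric equation** (DLMF 15.10.13): for
`a+b−c+1 ∉ −ℕ` and `‖1 − z‖ < 1`, `z(1−z)w₃″ + (c − (a+b+1)z)w₃′ − ab w₃ = 0` (the equation is
invariant under `z ↦ 1 − z, c ↦ a+b−c+1`). [cite: DLMF, 15.10.13] -/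
theorem kummer₃_ode (hγ : ∀ n : ℕ, a + b - c + 1 ≠ -n) {z : ℂ} (hz : ‖1 - z‖ < 1) :
    z * (1 - z) * kummer₃Deriv₂ a b c z + (c - (a + b + 1) * z) * kummer₃Deriv a b c z -
      a * b * kummer₃ a b c z = 0 := by
  have h := ordinaryHypergeometric_ode (a := a) (b := b) (c := a + b - c + 1) hγ hz
  rw [show a + b - c + 1 + 1 = a + b - c + 2 by ring,
    show a + b - c + 1 + 2 = a + b - c + 3 by ring] at h
  simp only [kummer₃, kummer₃Deriv, kummer₃Deriv₂]
  linear_combination h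

end Kummer3

/-! ### `w₄` solves the hypergeometric equation on `‖1 − z‖ < 1`, `1 − z ∉ (−∞, 0]` -/

section Kummer4

/-- **The Euler factor at the level of the equation** (pointwise algebra): if `H₀, H₁, H₂`
satisfy the `(c−a, c−b, c)` equation at `z` and `P = (1−z)Q`, `Q = (1−z)R` (`= (1−z)^{s, s−1, s−2}`,
`s = c−a−b`), then `PH₀, −sQH₀ + PH₁, s(s−1)RH₀ − 2sQH₁ + PH₂` satisfy the `(a, b, c)` equation.
[cite: DLMF, 15.10.14] -/
theorem ode_euler_factor {a b c z P Q R H₀ H₁ H₂ : ℂ} (hP : P = (1 - z) * Q)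
    (hQ : Q = (1 - z) * R)
    (hH : z * (1 - z) * H₂ + (c - (c - a + (c - b) + 1) * z) * H₁ - (c - a) * (c - b) * H₀ = 0) :
    z * (1 - z) * ((c - a - b) * (c - a - b - 1) * R * H₀ - 2 * ((c - a - b) * Q) * H₁ + P * H₂) +
      (c - (a + b + 1) * z) * (-((c - a - b) * Q) * H₀ + P * H₁) - a * b * (P * H₀) = 0 := by
  subst hP hQ
  linear_combination (1 - z) ^ 2 * R * hH

/-- `w^{p} = w·w^{p−1}` for `w ≠ 0`. [folklore] -/
theorem cpow_eq_self_mul_cpow_sub_one {w : ℂ} (hw : w ≠ 0) (p : ℂ) : w ^ p = w * w ^ (p - 1) := by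
  have h := Complex.cpow_add (p - 1) 1 hw
  rw [sub_add_cancel, Complex.cpow_one] at h
  rw [h, mul_comm]

variable (a b c : ℂ)

/-- `w₄` has derivative `w₄′` on `‖1 − z‖ < 1`, `1 − z ∉ (−∞,0]`. [cite: DLMF, 15.10.14] -/
theorem hasDerivAt_kummer₄ {z : ℂ} (hz : ‖1 - z‖ < 1) (hz' : 1 - z ∈ Complex.slitPlane) :
    HasDerivAt (kummer₄ a b c) (kummer₄Deriv a b c z) z := by
  have h1 : HasDerivAt (fun w : ℂ => 1 - w) (-1) z := (hasDerivAt_id' z).const_sub 1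
  have hp : HasDerivAt (fun w : ℂ => (1 - w) ^ (c - a - b))
      ((c - a - b) * (1 - z) ^ (c - a - b - 1) * (-1)) z := h1.cpow_const hz'
  have h := hp.mul (hasDerivAt_kummer₃ (c - a) (c - b) c hz)
  exact h.congr_deriv (by simp only [kummer₄Deriv]; ring)

/-- `w₄′` has derivative `w₄″` on `‖1 − z‖ < 1`, `1 − z ∉ (−∞,0]`. [cite: DLMF, 15.10.14] -/
theorem hasDerivAt_kummer₄Deriv {z : ℂ} (hz : ‖1 - z‖ < 1) (hz' : 1 - z ∈ Complex.slitPlane) :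
    HasDerivAt (kummer₄Deriv a b c) (kummer₄Deriv₂ a b c z) z := by
  have h1 : HasDerivAt (fun w : ℂ => 1 - w) (-1) z := (hasDerivAt_id' z).const_sub 1
  have hp : HasDerivAt (fun w : ℂ => (1 - w) ^ (c - a - b))
      ((c - a - b) * (1 - z) ^ (c - a - b - 1) * (-1)) z := h1.cpow_const hz'
  have hp1 : HasDerivAt (fun w : ℂ => (1 - w) ^ (c - a - b - 1))
      ((c - a - b - 1) * (1 - z) ^ (c - a - b - 1 - 1) * (-1)) z := h1.cpow_const hz'
  have h := (((hp1.const_mul (c - a - b)).neg).mul (hasDerivAt_kummer₃ (c - a) (c - b) c hz)).add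
    (hp.mul (hasDerivAt_kummer₃Deriv (c - a) (c - b) c hz))
  rw [show c - a - b - 1 - 1 = c - a - b - 2 by ring] at h
  exact h.congr_deriv (by simp only [kummer₄Deriv₂, Pi.neg_apply]; ring)

variable {a b c}

/-- **Kummer's solution `w₄` solves the hypergeometric equation** (DLMF 15.10.14): for
`c−a−b+1 ∉ −ℕ`, `‖1 − z‖ < 1` and `1 − z ≠ 0`,
`z(1−z)w₄″ + (c − (a+b+1)z)w₄′ − ab w₄ = 0`. [cite: DLMF, 15.10.14] -/
theorem kummer₄_ode (hγ' : ∀ n : ℕ, c - a - b + 1 ≠ -n) {z : ℂ} (hz : ‖1 - z‖ < 1)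
    (h1 : 1 - z ≠ 0) :
    z * (1 - z) * kummer₄Deriv₂ a b c z + (c - (a + b + 1) * z) * kummer₄Deriv a b c z -
      a * b * kummer₄ a b c z = 0 := by
  have hγ'' : ∀ n : ℕ, c - a + (c - b) - c + 1 ≠ -n := fun n => by
    rw [show c - a + (c - b) - c + 1 = c - a - b + 1 by ring]; exact hγ' n
  have hH := kummer₃_ode hγ'' hz
  have hP := cpow_eq_self_mul_cpow_sub_one h1 (c - a - b)
  have hQ := cpow_eq_self_mul_cpow_sub_one h1 (c - a - b - 1)
  rw [show c - a - b - 1 - 1 = c - a - b - 2 by ring] at hQ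
  simp only [kummer₄, kummer₄Deriv, kummer₄Deriv₂]
  exact ode_euler_factor hP hQ hH

/-- `(1−z)^{−s} w₄(z) = ₂F₁(c−a, c−b; s+1; 1−z)` (`s = c−a−b`, `1 − z ≠ 0`). [cite: DLMF, 15.10.14] -/
theorem cpow_neg_mul_kummer₄ (a b c : ℂ) {z : ℂ} (h1 : 1 - z ≠ 0) :
    (1 - z) ^ (-(c - a - b)) * kummer₄ a b c z = kummer₃ (c - a) (c - b) c z := by
  rw [kummer₄, ← mul_assoc, Complex.cpow_neg, inv_mul_cancel₀
    (Complex.cpow_ne_zero_iff.2 (Or.inl h1)), one_mul]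

/-- `(1−z)^{1−s} w₄′(z) = −s·w₃(c−a,c−b,c;z) + (1−z)·w₃′(c−a,c−b,c;z)` (`1 − z ≠ 0`).
[cite: DLMF, 15.10.14] -/
theorem cpow_mul_kummer₄Deriv (a b c : ℂ) {z : ℂ} (h1 : 1 - z ≠ 0) :
    (1 - z) ^ (1 - (c - a - b)) * kummer₄Deriv a b c z =
      -(c - a - b) * kummer₃ (c - a) (c - b) c z +
        (1 - z) * kummer₃Deriv (c - a) (c - b) c z := by
  have e1 : (1 - z) ^ (1 - (c - a - b)) * (1 - z) ^ (c - a - b - 1) = 1 := by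
    rw [← Complex.cpow_add _ _ h1, show 1 - (c - a - b) + (c - a - b - 1) = 0 by ring,
      Complex.cpow_zero]
  have e2 : (1 - z) ^ (1 - (c - a - b)) * (1 - z) ^ (c - a - b) = 1 - z := by
    rw [← Complex.cpow_add _ _ h1, show 1 - (c - a - b) + (c - a - b) = 1 by ring,
      Complex.cpow_one]
  rw [kummer₄Deriv]
  linear_combination (-(c - a - b) * kummer₃ (c - a) (c - b) c z) * e1 +
    kummer₃Deriv (c - a) (c - b) c z * e2

end Kummer4

/-! ### The real segment `0 < x < 1` and the behaviour at `x → 1⁻` -/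

section Real

/-- For `0 < x` real with `x < 2`… precisely for `x ∈ (0,1)`: `‖1 − x‖ < 1`. [folklore] -/
theorem norm_one_sub_ofReal_lt_one {x : ℝ} (hx : x ∈ Ioo (0 : ℝ) 1) : ‖1 - (x : ℂ)‖ < 1 := by
  rw [show (1 : ℂ) - x = ((1 - x : ℝ) : ℂ) by push_cast; ring, Complex.norm_real,
    Real.norm_eq_abs, abs_lt]
  constructor <;> linarith [hx.1, hx.2]

/-- For real `x < 1`, `1 − x` lies in the slit plane. [folklore] -/
theorem one_sub_ofReal_mem_slitPlane {x : ℝ} (hx : x < 1) : 1 - (x : ℂ) ∈ Complex.slitPlane := by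
  rw [show (1 : ℂ) - x = ((1 - x : ℝ) : ℂ) by push_cast; ring]
  exact Complex.ofReal_mem_slitPlane.2 (by linarith)

/-- For real `x < 1`, `1 − x ≠ 0` in `ℂ`. [folklore] -/
theorem one_sub_ofReal_ne_zero {x : ℝ} (hx : x < 1) : (1 : ℂ) - x ≠ 0 :=
  Complex.slitPlane_ne_zero (one_sub_ofReal_mem_slitPlane hx)

variable (a b c : ℂ)

/-- `₂F₁(α, β; γ; 1 − z) → 1` as `z → 1`. [cite: DLMF, 15.2.1] -/
theorem tendsto_ordinaryHypergeometric_one_sub (α β γ : ℂ) :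
    Tendsto (fun z : ℂ => ₂F₁ α β γ (1 - z)) (𝓝 1) (𝓝 1) := by
  have hc : ContinuousAt (₂F₁ α β γ : ℂ → ℂ) 0 :=
    (continuousOn_ordinaryHypergeometric α β γ).continuousAt
      (isOpen_ball.mem_nhds (mem_ball_self one_pos))
  have h1 : Tendsto (fun z : ℂ => 1 - z) (𝓝 1) (𝓝 0) := by
    simpa using (continuous_sub_left (1 : ℂ)).tendsto 1
  have h := hc.tendsto.comp h1
  rwa [ordinaryHypergeometric_zero] at h

/-- Real `x → 1⁻` pushed into `ℂ`: `(x : ℂ) → 1`. [folklore] -/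
theorem tendsto_ofReal_nhdsLT_one : Tendsto (fun x : ℝ => (x : ℂ)) (𝓝[<] 1) (𝓝 1) := by
  simpa using (Complex.continuous_ofReal.tendsto (1 : ℝ)).mono_left nhdsWithin_le_nhds

/-- `w₃(x) → 1` as `x → 1⁻`. [cite: DLMF, 15.10.13] -/
theorem tendsto_kummer₃_nhdsLT_one :
    Tendsto (fun x : ℝ => kummer₃ a b c x) (𝓝[<] 1) (𝓝 1) :=
  (tendsto_ordinaryHypergeometric_one_sub a b (a + b - c + 1)).comp tendsto_ofReal_nhdsLT_one

/-- `w₃′(x) → −ab/(a+b−c+1)` as `x → 1⁻`. [cite: DLMF, 15.10.13] -/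
theorem tendsto_kummer₃Deriv_nhdsLT_one :
    Tendsto (fun x : ℝ => kummer₃Deriv a b c x) (𝓝[<] 1) (𝓝 (-(a * b / (a + b - c + 1)))) := by
  have h := ((tendsto_ordinaryHypergeometric_one_sub (a + 1) (b + 1) (a + b - c + 2)).comp
    tendsto_ofReal_nhdsLT_one).const_mul (a * b / (a + b - c + 1))
  simpa [kummer₃Deriv, Function.comp_def] using h.neg

/-- `(1 − x) w₃′(x) → 0` as `x → 1⁻`. [cite: DLMF, 15.10.13] -/
theorem tendsto_one_sub_mul_kummer₃Deriv_nhdsLT_one :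
    Tendsto (fun x : ℝ => (1 - (x : ℂ)) * kummer₃Deriv a b c x) (𝓝[<] 1) (𝓝 0) := by
  have h1 : Tendsto (fun x : ℝ => 1 - (x : ℂ)) (𝓝[<] 1) (𝓝 0) := by
    simpa using (tendsto_const_nhds (x := (1 : ℂ))).sub tendsto_ofReal_nhdsLT_one
  simpa using h1.mul (tendsto_kummer₃Deriv_nhdsLT_one a b c)

/-- `(1−x)^{1−s} w₄′(x) → −s` as `x → 1⁻` (`s = c−a−b`). [cite: DLMF, 15.10.14] -/
theorem tendsto_cpow_mul_kummer₄Deriv_nhdsLT_one :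
    Tendsto (fun x : ℝ => (1 - (x : ℂ)) ^ (1 - (c - a - b)) * kummer₄Deriv a b c x) (𝓝[<] 1)
      (𝓝 (-(c - a - b))) := by
  have h := ((tendsto_kummer₃_nhdsLT_one (c - a) (c - b) c).const_mul (-(c - a - b))).add
    (tendsto_one_sub_mul_kummer₃Deriv_nhdsLT_one (c - a) (c - b) c)
  rw [mul_one, add_zero] at h
  refine h.congr' ?_
  filter_upwards [self_mem_nhdsWithin] with x hx
  exact (cpow_mul_kummer₄Deriv a b c (one_sub_ofReal_ne_zero hx)).symm

/-- `(1−x)^{1−s}(w₃w₄′ − w₃′w₄)(x) → −s` as `x → 1⁻`. [cite: DLMF, 15.10(ii)] -/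
theorem tendsto_cpow_mul_wronskian_nhdsLT_one :
    Tendsto (fun x : ℝ => (1 - (x : ℂ)) ^ (1 - (c - a - b)) *
      (kummer₃ a b c x * kummer₄Deriv a b c x - kummer₃Deriv a b c x * kummer₄ a b c x))
      (𝓝[<] 1) (𝓝 (-(c - a - b))) := by
  have h := ((tendsto_kummer₃_nhdsLT_one a b c).mul
    (tendsto_cpow_mul_kummer₄Deriv_nhdsLT_one a b c)).sub
    ((tendsto_one_sub_mul_kummer₃Deriv_nhdsLT_one a b c).mul
      (tendsto_kummer₃_nhdsLT_one (c - a) (c - b) c))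
  rw [one_mul, zero_mul, sub_zero] at h
  refine h.congr' ?_
  filter_upwards [self_mem_nhdsWithin] with x hx
  have h1 := one_sub_ofReal_ne_zero hx
  rw [← cpow_neg_mul_kummer₄ a b c h1]
  have e : (1 - (x : ℂ)) ^ (1 - (c - a - b)) = (1 - (x : ℂ)) * (1 - (x : ℂ)) ^ (-(c - a - b)) := by
    rw [show 1 - (c - a - b) = -(c - a - b) + 1 by ring, Complex.cpow_add _ _ h1,
      Complex.cpow_one, mul_comm]
  rw [e]
  ring

end Real

/-! ### The Wronskian of `w₃, w₄` (Abel's identity) -/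

section Wronskian

variable {a b c : ℂ}

/-- **The Wronskian of Kummer's solutions at `1`**: for `a+b−c+1, c−a−b+1 ∉ −ℕ` and
`0 < x < 1`, `w₃w₄′ − w₃′w₄ = (a+b−c) x^{−c} (1−x)^{c−a−b−1}` (Abel's identity
`W′ = −((c − (a+b+1)x)/(x(1−x))) W`, i.e. `x^{c}(1−x)^{1−s}W` is constant on `(0,1)`, and its
limit at `1⁻` is `−s = a+b−c` by `w₃ → 1`, `(1−x)^{1−s}w₄′ → −s`). [cite: DLMF, 15.10(ii)] -/
theorem kummer_wronskian (hγ : ∀ n : ℕ, a + b - c + 1 ≠ -n) (hγ' : ∀ n : ℕ, c - a - b + 1 ≠ -n)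
    {x : ℝ} (hx : x ∈ Ioo (0 : ℝ) 1) :
    kummer₃ a b c x * kummer₄Deriv a b c x - kummer₃Deriv a b c x * kummer₄ a b c x =
      (a + b - c) * (x : ℂ) ^ (-c) * (1 - (x : ℂ)) ^ (c - a - b - 1) := by
  -- the Wronskian and the candidate constant `V = x^c (1−x)^{1−s} W`
  set W : ℝ → ℂ := fun y => kummer₃ a b c y * kummer₄Deriv a b c y -
    kummer₃Deriv a b c y * kummer₄ a b c y with hW
  set V : ℝ → ℂ := fun y => (y : ℂ) ^ c * (1 - (y : ℂ)) ^ (1 - (c - a - b)) * W y with hV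
  -- `V' = 0` on `(0,1)`
  have hVd : ∀ y ∈ Ioo (0 : ℝ) 1, HasDerivAt V 0 y := by
    intro y hy
    have hy0 : (y : ℂ) ≠ 0 := Complex.ofReal_ne_zero.2 hy.1.ne'
    have hy1 : (1 : ℂ) - y ≠ 0 := one_sub_ofReal_ne_zero hy.2
    have hn := norm_one_sub_ofReal_lt_one hy
    have hsl := one_sub_ofReal_mem_slitPlane hy.2
    have hode3 := kummer₃_ode hγ hn
    have hode4 := kummer₄_ode hγ' hn hy1
    have hWd : HasDerivAt W (kummer₃ a b c y * kummer₄Deriv₂ a b c y -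
        kummer₃Deriv₂ a b c y * kummer₄ a b c y) y :=
      (((hasDerivAt_kummer₃ a b c hn).comp_ofReal.mul
        (hasDerivAt_kummer₄Deriv a b c hn hsl).comp_ofReal).sub
        ((hasDerivAt_kummer₃Deriv a b c hn).comp_ofReal.mul
          (hasDerivAt_kummer₄ a b c hn hsl).comp_ofReal)).congr_deriv (by ring)
    have hpc : HasDerivAt (fun t : ℝ => (t : ℂ) ^ c) (c * (y : ℂ) ^ (c - 1) * 1) y :=
      ((hasDerivAt_id' (y : ℂ)).cpow_const (Complex.ofReal_mem_slitPlane.2 hy.1)).comp_ofReal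
    have hp1 : HasDerivAt (fun t : ℝ => (1 - (t : ℂ)) ^ (1 - (c - a - b)))
        ((1 - (c - a - b)) * (1 - (y : ℂ)) ^ (1 - (c - a - b) - 1) * (-1)) y :=
      (((hasDerivAt_id' (y : ℂ)).const_sub 1).cpow_const
        (one_sub_ofReal_mem_slitPlane hy.2)).comp_ofReal
    have hVd' := (hpc.mul hp1).mul hWd
    refine hVd'.congr_deriv ?_
    -- the algebra (Abel): multiply by `y(1−y) ≠ 0`
    have ey := cpow_eq_self_mul_cpow_sub_one hy0 c
    have e1 := cpow_eq_self_mul_cpow_sub_one hy1 (1 - (c - a - b))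
    refine mul_left_cancel₀ (mul_ne_zero hy0 hy1) ?_
    rw [mul_zero]
    set P := (1 - (y : ℂ)) ^ (1 - (c - a - b) - 1) with hP
    set Y := (y : ℂ) ^ (c - 1) with hY
    simp only [Pi.mul_apply, hW]
    rw [ey, e1]
    linear_combination ((y : ℂ) * Y * ((1 - (y : ℂ)) * P) * kummer₃ a b c y) * hode4 -
      ((y : ℂ) * Y * ((1 - (y : ℂ)) * P) * kummer₄ a b c y) * hode3
  -- hence `V` is constant on `(0,1)`
  have hVdiff : DifferentiableOn ℝ V (Ioo 0 1) := fun y hy =>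
    (hVd y hy).differentiableAt.differentiableWithinAt
  have hVconst : ∀ y ∈ Ioo (0 : ℝ) 1, V y = V x := fun y hy =>
    isOpen_Ioo.is_const_of_deriv_eq_zero (convex_Ioo 0 1).isPreconnected hVdiff
      (fun t ht => (hVd t ht).deriv) hy hx
  -- and its limit at `1⁻` is `−s`
  have hVlim : Tendsto V (𝓝[<] 1) (𝓝 (-(c - a - b))) := by
    have hc1 : Tendsto (fun y : ℝ => (y : ℂ) ^ c) (𝓝[<] 1) (𝓝 1) := by
      have hca : ContinuousAt (fun w : ℂ => w ^ c) 1 :=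
        continuousAt_id.cpow continuousAt_const (Or.inl (by simp))
      have h := hca.tendsto.comp tendsto_ofReal_nhdsLT_one
      simpa [Function.comp_def] using h
    have h := hc1.mul (tendsto_cpow_mul_wronskian_nhdsLT_one a b c)
    rw [one_mul] at h
    refine h.congr' (Eventually.of_forall fun y => ?_)
    simp only [hV, hW]
    ring
  have hVx : V x = -(c - a - b) := by
    have hev : V =ᶠ[𝓝[<] (1 : ℝ)] fun _ => V x := by
      filter_upwards [Ioo_mem_nhdsLT hx.2] with y hy using hVconst y ⟨hx.1.trans hy.1, hy.2⟩
    exact tendsto_nhds_unique (hVlim.congr' hev) tendsto_const_nhds ▸ rfl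
  -- unwind
  have hxc : (x : ℂ) ^ c ≠ 0 :=
    Complex.cpow_ne_zero_iff.2 (Or.inl (Complex.ofReal_ne_zero.2 hx.1.ne'))
  have hxs : (1 - (x : ℂ)) ^ (1 - (c - a - b)) ≠ 0 :=
    Complex.cpow_ne_zero_iff.2 (Or.inl (one_sub_ofReal_ne_zero hx.2))
  have key : (x : ℂ) ^ c * (1 - (x : ℂ)) ^ (1 - (c - a - b)) * W x = -(c - a - b) := hVx
  have e2 : (1 - (x : ℂ)) ^ (c - a - b - 1) = ((1 - (x : ℂ)) ^ (1 - (c - a - b)))⁻¹ := by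
    rw [← Complex.cpow_neg, neg_sub]
  show W x = _
  rw [Complex.cpow_neg, e2]
  field_simp
  linear_combination key

/-- **Independence of Kummer's solutions at `1`**: for `c − a − b ≠ 0` (and
`a+b−c+1, c−a−b+1 ∉ −ℕ`) the Wronskian `w₃w₄′ − w₃′w₄` does not vanish on `(0,1)`.
[cite: DLMF, 15.10(ii)] -/
theorem kummer_wronskian_ne_zero (hγ : ∀ n : ℕ, a + b - c + 1 ≠ -n)
    (hγ' : ∀ n : ℕ, c - a - b + 1 ≠ -n) (hs : c - a - b ≠ 0) {x : ℝ} (hx : x ∈ Ioo (0 : ℝ) 1) :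
    kummer₃ a b c x * kummer₄Deriv a b c x - kummer₃Deriv a b c x * kummer₄ a b c x ≠ 0 := by
  rw [kummer_wronskian hγ hγ' hx]
  refine mul_ne_zero (mul_ne_zero (fun h => hs (by linear_combination -h))
    (Complex.cpow_ne_zero_iff.2 (Or.inl (Complex.ofReal_ne_zero.2 hx.1.ne'))))
    (Complex.cpow_ne_zero_iff.2 (Or.inl (one_sub_ofReal_ne_zero hx.2)))

end Wronskian

end Literature.Analysis.SpecialFunctions.Hypergeometric

end
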